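import Literature.AlgebraicGeometry.Motives.BettiRealization
import Literature.AlgebraicGeometry.Motives.HodgeStructureWeil
import HarnessLib

/-!
# The Weil re-decoration of a Betti–Hodge realization datum

`Literature.AlgebraicGeometry.Motives.BettiHodgeData k` (`Motives/BettiRealization`) is a
HYPOTHESIS STRUCTURE standing in for the classical Betti–Hodge realization: a Weil cohomology
`W`, a comparison `iso` with Betti cohomology, and, for each smooth projective `X` and each `i`,
SOME pure Hodge structure `B.hodge hX i` of weight `i` on `Hⁱ(X)`, subject only to (a) pull-backs
are morphisms of Hodge structures, (b) each `B.hodge hX i` is polarizable, (c) cycle classes are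
Hodge classes (a condition in even degree `2p`). This file records that these axioms do NOT
determine the Hodge numbers in odd degree: from any datum `B` we build `B.weil` with the same
`W` and `iso`, whose Hodge structure on `Hⁱ(X)` is Weil's two-type structure
`(B.hodge hX i).weil` of `Motives/HodgeStructureWeil` (`V^{i,0} = ⊕_{p odd} V^{p,i-p}`, `V^{0,i}`
its conjugate — Weil's weight-one structure `(H, C)` of Carlson–Müller-Stach–Peters, *Period
Mappings and Period Domains*, §3.5, eq. (3.5), types relabelled) for odd `i`, and unchanged for
even `i`. Since `H ↦ H.weil` is functorial (`Hom.weil`) and preserves polarizability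
(`IsPolarizable.weil`), and even degrees are untouched, (a)–(c) survive; but
`2 · h^{l,0}(B.weil, X) = b_l(X)` for odd `l` (`BettiHodgeData.two_mul_hodgeNumber_weil`).

Used in `Literature/Barriers/HodgeConjecture/DecompositionOfTheDiagonalProofs.lean` to show
that the `B`-parametrised rendering of Voisin II, Thm. 10.4 cannot hold for all data `B`.

## References

* J. Carlson, S. Müller-Stach, C. Peters, *Period Mappings and Period Domains*, 2nd ed.,
  CUP 2017, §3.5, eq. (3.5) (Weil's Hodge structure `(H, C)`; Weil's Jacobian is an abelian
  variety).
* S. Kleiman, *Algebraic cycles and the Weil conjectures* (1968), §1.2 (A) (finite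
  dimensionality of `Hⁱ(X)`).
-/

noncomputable section

open CategoryTheory AlgebraicGeometry

namespace Literature.AlgebraicGeometry.Motives

namespace BettiHodgeData

variable {k : Type} [Field k] [Algebra k ℂ]

/-- **The Weil re-decoration of a Betti–Hodge realization datum**: same Weil cohomology `W`,
same comparison `iso` with Betti cohomology, but the Hodge structure on each `Hⁱ(X)` replaced by
Weil's two-type structure `(B.hodge hX i).weil` (`V^{i,0} = ⊕_{p odd} V^{p,i-p}`, `V^{0,i}` its
conjugate) in odd degree `i`, unchanged in even degree. The axioms of `BettiHodgeData` survive: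
pull-backs remain morphisms (`HodgeStructure.Hom.weil`), polarizability is preserved
(`HodgeStructure.IsPolarizable.weil`; Carlson–Müller-Stach–Peters §3.5: Weil's Jacobian is an
abelian variety), and cycle classes live in even degree `2p`, where nothing changed.
[cite: CarlsonMullerStachPeters2017, §3.5 eq. (3.5)] -/
def weil (B : BettiHodgeData k) : BettiHodgeData k where
  W := B.W
  iso := B.iso
  iso_cup := B.iso_cup
  iso_one := B.iso_one
  hodge _ _ hX i := (B.hodge hX i).weil
  pullback_hom _ _ hX _ _ hY f i := by
    obtain ⟨φ, hφ⟩ := B.pullback_hom hX hY f i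
    exact ⟨φ.weil, hφ⟩
  polarizable _ _ hX i := (B.polarizable hX i).weil
  cycleClass_mem_hodgeClasses _ _ hX p z hz := by
    have h : ¬(Odd ((2 * p : ℕ) : ℤ) ∧ 0 < ((2 * p : ℕ) : ℤ)) := fun h ↦
      (Int.not_even_iff_odd.2 h.1) ⟨p, by push_cast; ring⟩
    change B.W.cycleClass _ p z ∈ ((B.hodge hX (2 * p)).weil).hodgeClasses p
    rw [HodgeStructure.weil_of_not _ h]
    exact B.cycleClass_mem_hodgeClasses hX p z hz

/-- The Weil re-decoration keeps the Weil cohomology (and the comparison). [folklore] -/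
@[simp]
theorem weil_W (B : BettiHodgeData k) : B.weil.W = B.W := rfl

/-- The Hodge structures of the Weil re-decoration are the Weil two-type structures of the
original ones. [folklore] -/
theorem weil_hodge (B : BettiHodgeData k) {n : ℕ} {X : SchemeOver k} (hX : IsSmoothProjective n X)
    (i : ℕ) : B.weil.hodge hX i = (B.hodge hX i).weil := rfl

/-- In even degree the Weil re-decoration changes nothing. [folklore] -/
theorem weil_hodge_two_mul (B : BettiHodgeData k) {n : ℕ} {X : SchemeOver k}
    (hX : IsSmoothProjective n X) (p : ℕ) : B.weil.hodge hX (2 * p) = B.hodge hX (2 * p) := by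
  have h : ¬(Odd ((2 * p : ℕ) : ℤ) ∧ 0 < ((2 * p : ℕ) : ℤ)) := fun h ↦
    (Int.not_even_iff_odd.2 h.1) ⟨p, by push_cast; ring⟩
  exact HodgeStructure.weil_of_not _ h

/-- **Odd-degree Hodge numbers of the Weil re-decoration:** `2 · h^{l,0}(B.weil, X) = b_l(X)`
for odd `l`, where `b_l(X) = dim_ℚ Hˡ(X(ℂ); ℚ)` is the Betti number (`W.obj X l ≃ Hˡ_B(X)` by
`B.iso`; `Hˡ(X)` is finite-dimensional by the Weil axiom (A), Kleiman §1.2). [cite: CarlsonMullerStachPeters2017, §3.5 eq. (3.5)] -/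
theorem two_mul_hodgeNumber_weil (B : BettiHodgeData k) {n : ℕ} {X : SchemeOver k}
    (hX : IsSmoothProjective n X) {l : ℕ} (hl : Odd l) :
    2 * (B.weil.hodge hX l).hodgeNumber l 0 = Module.finrank ℚ (bettiCohomology X l) := by
  haveI : Module.Finite ℚ (B.W.obj X l) := B.W.finite_obj hX l
  have hodd : Odd (l : ℤ) ∧ 0 < (l : ℤ) := ⟨by exact_mod_cast hl, by exact_mod_cast hl.pos⟩
  have h := HodgeStructure.two_mul_hodgeNumber_weil (B.hodge hX l) hodd
  rw [(B.isoObj X l).finrank_eq] at h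
  exact h

/-- For odd `l` with `Hˡ(X(ℂ); ℚ) ≠ 0`, the Weil re-decoration has `h^{l,0}(X) ≠ 0`. [folklore] -/
theorem hodgeNumber_weil_ne_zero (B : BettiHodgeData k) {n : ℕ} {X : SchemeOver k}
    (hX : IsSmoothProjective n X) {l : ℕ} (hl : Odd l) (hb : Nontrivial (bettiCohomology X l)) :
    (B.weil.hodge hX l).hodgeNumber l 0 ≠ 0 := by
  intro h0
  haveI : Module.Finite ℚ (B.W.obj X l) := B.W.finite_obj hX l
  haveI : Module.Finite ℚ (bettiCohomology X l) :=
    Module.Finite.of_surjective (B.isoObj X l).toLinearMap (B.isoObj X l).surjective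
  have h2 := B.two_mul_hodgeNumber_weil hX hl
  rw [h0, mul_zero] at h2
  exact Module.finrank_pos.ne' h2.symm

end BettiHodgeData

end Literature.AlgebraicGeometry.Motives

end
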